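/-
Copyright (c) 2026. All rights reserved.
Released under Apache 2.0 license as described in the file LICENSE.
-/
import Literature.MathematicalPhysics.QuantumLattice.BlockProductStates
import Literature.MathematicalPhysics.QuantumLattice.SpinEmbedding
import HarnessLib

/-!
# Block-product operators and heterogeneous block-product states (D44 soundness layer, part 1)

HONEST FRAMING: ladder R1–R4 with certified numbers; no claim on H/H₀. These are bounds for
MODEL CLASSES (reference quantum spin models on finite tori), no materials claim.

Generic tensor-product bookkeeping over a block decomposition `e : Λ ≃ B × F` of the sites of a
finite quantum spin system (`blockCfg`, `blockProductState` of the tree's `BlockProductStates`),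
needed to evaluate EXACTLY the energy of a finite-depth circuit applied to a cluster product state
(D44, the `HeisTorusFamilyUpper 2 6 q` node of `ManyBodyBootstrap/Bounds/E2`):

* `blockProductOp e u = ⨂_b u_b` (entrywise `∏_b u_b(σ|_b, τ|_b)`): multiplicative, unital, a `*`-map,
  hence unitary for unitary factors (`blockProductOp_mul/_one/_conjTranspose`,
  `conjTranspose_blockProductOp_mul_self`); a single non-identity factor is the tree's embedded
  operator `spinEmbed (blockEmb e b) X` (`blockProductOp_update_eq_spinEmbed`), in particular
  `onSite (e⁻¹(b,f)) a = blockProductOp e (1[b ↦ onSite f a])`;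
* `blockProductStates e χ = ⨂_b χ_b` with DIFFERENT factors: inner products factorise
  (`star_blockProductStates_dotProduct`) and `⨂_b u_b` acts factorwise
  (`blockProductOp_mulVec_blockProductStates`);
* **corners**: an operator embedded along `emb : G ↪ Λ` whose sites lie in PAIRWISE DIFFERENT blocks
  (`e (emb g) = (blk g, pos g)`, `blk` injective) acts on `⨂_b χ_b` matrix unit by matrix unit,
  each unit acting on the `|G|` touched factors by single-site units
  (`spinEmbed_single_eq_blockProductOp`, `spinEmbed_mulVec_blockProductStates`,
  `expect_spinEmbed_blockProductStates`). This is the two-tiling situation of D44 (a dual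
  plaquette meets four different `2 × 2` clusters, one site each).

No numerics, no `decide`; standard axioms only.
References: H. Tasaki, *Physics and Mathematics of Quantum Many-Body Systems* (2020) §2.2
[Tasaki2020]; O. Bratteli, D. W. Robinson, *Operator Algebras and QSM II* (1997) §6.2.1
[BratteliRobinsonII1997].
-/

noncomputable section

namespace Summit.HubbardSuperconductivity.HubbardLadder.Bounds

open Matrix Finset Complex
open Literature.MathematicalPhysics.QuantumLattice

variable {Λ B F G : Type*} {q : ℕ}

/-! ### Definitions -/

/-- **The block-product operator** `⨂_b u_b` along `e : Λ ≃ B × F`, entrywise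
`⟨σ| ⨂_b u_b |τ⟩ = ∏_b u_b (σ|_b) (τ|_b)`. Tasaki (2020) §2.2. [folklore] -/
def blockProductOp [Fintype B] (e : Λ ≃ B × F) (u : B → Op F q) : Op Λ q :=
  of fun σ τ => ∏ b, u b (blockCfg e σ b) (blockCfg e τ b)

/-- **The heterogeneous block-product state** `⨂_b χ_b`: `σ ↦ ∏_b χ_b (σ|_b)`.
Tasaki (2020) §2.2, eq. (2.2.3). [folklore] -/
def blockProductStates [Fintype B] (e : Λ ≃ B × F) (χ : B → TensorIndex F q → ℂ) :
    TensorIndex Λ q → ℂ :=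
  fun σ => ∏ b, χ b (blockCfg e σ b)

/-- The sites of block `b`: `f ↦ e⁻¹ (b, f)`. [folklore] -/
def blockEmb (e : Λ ≃ B × F) (b : B) : F ↪ Λ :=
  ⟨fun f => e.symm (b, f), fun _ _ h => (Prod.ext_iff.1 (e.symm.injective h)).2⟩

/-- **Corner operators**: for sites `g : G` placed in blocks `blk g` at positions `pos g` and
single-site matrices `m g`, the operator acting on the factor of block `a` — `onSite (pos g) (m g)`
if `a = blk g` (at most one such `g` when `blk` is injective), the identity otherwise; written as a
sum so that no choice of `g` is needed. [this file] -/
def cornerOp [Fintype F] [DecidableEq F] [Fintype G] [DecidableEq B] (blk : G → B) (pos : G → F)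
    (m : G → Matrix (Fin q) (Fin q) ℂ) (a : B) : Op F q :=
  1 + ∑ g, if blk g = a then onSite (pos g) (m g) - 1 else 0

section Algebra

variable [Fintype Λ] [DecidableEq Λ] [Fintype B] [DecidableEq B] [Fintype F] [DecidableEq F]

omit [Fintype Λ] [DecidableEq Λ] [DecidableEq B] [Fintype F] [DecidableEq F] in
/-- Entries of `⨂_b u_b` (definitional). [folklore] -/
theorem blockProductOp_apply (e : Λ ≃ B × F) (u : B → Op F q) (σ τ : TensorIndex Λ q) :
    blockProductOp e u σ τ = ∏ b, u b (blockCfg e σ b) (blockCfg e τ b) := rfl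

omit [Fintype Λ] [DecidableEq Λ] [DecidableEq B] [Fintype F] [DecidableEq F] in
/-- Entries of `⨂_b χ_b` (definitional). [folklore] -/
theorem blockProductStates_apply (e : Λ ≃ B × F) (χ : B → TensorIndex F q → ℂ)
    (σ : TensorIndex Λ q) : blockProductStates e χ σ = ∏ b, χ b (blockCfg e σ b) := rfl

omit [Fintype Λ] [DecidableEq Λ] [DecidableEq B] [Fintype F] [DecidableEq F] in
/-- The homogeneous block product state is the heterogeneous one with equal factors. [folklore] -/
theorem blockProductState_eq_blockProductStates (e : Λ ≃ B × F) (φ : TensorIndex F q → ℂ) :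
    blockProductState e φ = blockProductStates e (fun _ => φ) := rfl

/-- **`(⨂_b u_b)(⨂_b v_b) = ⨂_b (u_b v_b)`** (Fubini over the blocks). Tasaki (2020) §2.2. [folklore] -/
theorem blockProductOp_mul (e : Λ ≃ B × F) (u v : B → Op F q) :
    blockProductOp e u * blockProductOp e v = blockProductOp e (fun b => u b * v b) := by
  ext σ τ
  simp only [mul_apply, blockProductOp_apply]
  set h : B → TensorIndex F q → ℂ := fun b ξ => u b (blockCfg e σ b) ξ * v b ξ (blockCfg e τ b)
    with hh
  have key : ∀ ρ : TensorIndex Λ q,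
      (∏ b, u b (blockCfg e σ b) (blockCfg e ρ b)) * ∏ b, v b (blockCfg e ρ b) (blockCfg e τ b) =
        ∏ b, h b (blockCfg e ρ b) := by
    intro ρ
    rw [← prod_mul_distrib]
  simp_rw [key]
  rw [sum_prod_blockCfg]

omit [DecidableEq Λ] [DecidableEq B] [DecidableEq F] in
/-- **`⨂_b 𝟙 = 𝟙`**. [folklore] -/
theorem blockProductOp_one (e : Λ ≃ B × F) : blockProductOp e (fun _ => (1 : Op F q)) = 1 := by
  ext σ τ
  rw [blockProductOp_apply]
  by_cases h : σ = τ
  · subst h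
    simp
  · rw [one_apply_ne h]
    have hb : ∃ b, blockCfg e σ b ≠ blockCfg e τ b := by
      by_contra hall
      push Not at hall
      exact h ((blockCfgEquiv e).injective (funext hall))
    obtain ⟨b, hb⟩ := hb
    exact prod_eq_zero (mem_univ b) (one_apply_ne hb)

omit [Fintype Λ] [DecidableEq Λ] [DecidableEq B] [Fintype F] [DecidableEq F] in
/-- **`(⨂_b u_b)ᴴ = ⨂_b u_bᴴ`**. [folklore] -/
theorem blockProductOp_conjTranspose (e : Λ ≃ B × F) (u : B → Op F q) :
    (blockProductOp e u)ᴴ = blockProductOp e (fun b => (u b)ᴴ) := by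
  ext σ τ
  simp only [conjTranspose_apply, blockProductOp_apply, star_prod]

/-- **A block product of unitaries is unitary**: `(⨂ u)ᴴ (⨂ u) = 𝟙` if `u_bᴴ u_b = 𝟙` for all `b`.
[folklore] -/
theorem conjTranspose_blockProductOp_mul_self (e : Λ ≃ B × F) {u : B → Op F q}
    (hu : ∀ b, (u b)ᴴ * u b = 1) : (blockProductOp e u)ᴴ * blockProductOp e u = 1 := by
  rw [blockProductOp_conjTranspose, blockProductOp_mul]
  simp only [hu]
  exact blockProductOp_one e

omit [Fintype Λ] [DecidableEq Λ] [Fintype B] [DecidableEq B] [Fintype F] [DecidableEq F] in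
/-- A site lies in the range of `blockEmb e b` iff its block is `b`. [folklore] -/
theorem mem_range_blockEmb_iff (e : Λ ≃ B × F) (b : B) (y : Λ) :
    y ∈ Set.range (blockEmb e b) ↔ (e y).1 = b := by
  constructor
  · rintro ⟨f, rfl⟩
    simp [blockEmb]
  · intro h
    exact ⟨(e y).2, by simp [blockEmb, ← h]⟩

/-- **A single non-identity factor is the embedded operator**:
`⨂_{b'} (𝟙[b ↦ X])_{b'} = spinEmbed (blockEmb e b) X = X_b ⊗ 𝟙`. Bratteli–Robinson II §6.2.1. [folklore] -/
theorem blockProductOp_update_eq_spinEmbed (e : Λ ≃ B × F) (b : B) (X : Op F q) :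
    blockProductOp e (Function.update (fun _ => (1 : Op F q)) b X) = spinEmbed (blockEmb e b) X := by
  ext σ τ
  rw [blockProductOp_apply, spinEmbed_apply, ← mul_prod_erase univ _ (mem_univ b),
    Function.update_self]
  have hrest : ∀ b' ∈ univ.erase b, (Function.update (fun _ => (1 : Op F q)) b X b')
      (blockCfg e σ b') (blockCfg e τ b') = (1 : Op F q) (blockCfg e σ b') (blockCfg e τ b') := by
    intro b' hb'
    rw [Function.update_of_ne (mem_erase.1 hb').1]
  rw [prod_congr rfl hrest]
  have hcfg : (fun f => σ (blockEmb e b f)) = blockCfg e σ b := rfl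
  have hcfg' : (fun f => τ (blockEmb e b f)) = blockCfg e τ b := rfl
  by_cases hoff : ∀ b' ≠ b, blockCfg e σ b' = blockCfg e τ b'
  · have h1 : ∏ b' ∈ univ.erase b, (1 : Op F q) (blockCfg e σ b') (blockCfg e τ b') = 1 :=
      prod_eq_one fun b' hb' => by rw [hoff b' (mem_erase.1 hb').1, one_apply_eq]
    rw [h1, mul_one, if_pos, hcfg, hcfg']
    intro y hy
    rw [mem_range_blockEmb_iff] at hy
    have := congrFun (hoff (e y).1 hy) (e y).2
    simpa [blockCfg] using this
  · push Not at hoff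
    obtain ⟨b', hb'b, hne⟩ := hoff
    have h0 : (1 : Op F q) (blockCfg e σ b') (blockCfg e τ b') = 0 := one_apply_ne hne
    rw [prod_eq_zero (mem_erase.2 ⟨hb'b, mem_univ b'⟩) h0, mul_zero, if_neg]
    intro hall
    apply hne
    funext f
    have hy : e.symm (b', f) ∉ Set.range (blockEmb e b) := by
      rw [mem_range_blockEmb_iff]
      simpa using hb'b
    exact hall _ hy

/-- **A single-site operator is a block product with one factor**:
`onSite (e⁻¹(b,f)) a = ⨂ (𝟙[b ↦ onSite f a])`. Tasaki (2020) §2.2, eq. (2.2.5). [folklore] -/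
theorem onSite_eq_blockProductOp (e : Λ ≃ B × F) {x : Λ} {b : B} {f : F} (hx : e x = (b, f))
    (a : Matrix (Fin q) (Fin q) ℂ) :
    onSite x a = blockProductOp e (Function.update (fun _ => (1 : Op F q)) b (onSite f a)) := by
  rw [blockProductOp_update_eq_spinEmbed, spinEmbed_onSite]
  congr 1
  change x = e.symm (b, f)
  rw [← hx, Equiv.symm_apply_apply]

/-! ### Heterogeneous block-product states -/

/-- **Inner products factorise**: `⟨⨂_b χ_b, ⨂_b χ'_b⟩ = ∏_b ⟨χ_b, χ'_b⟩`. Tasaki (2020) §2.2. [folklore] -/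
theorem star_blockProductStates_dotProduct (e : Λ ≃ B × F) (χ χ' : B → TensorIndex F q → ℂ) :
    star (blockProductStates e χ) ⬝ᵥ blockProductStates e χ' = ∏ b, (star (χ b) ⬝ᵥ χ' b) := by
  simp only [dotProduct, Pi.star_apply, blockProductStates_apply]
  set h : B → TensorIndex F q → ℂ := fun b ξ => star (χ b ξ) * χ' b ξ with hh
  have key : ∀ σ : TensorIndex Λ q, star (∏ b, χ b (blockCfg e σ b)) * ∏ b, χ' b (blockCfg e σ b) =
      ∏ b, h b (blockCfg e σ b) := by
    intro σ
    rw [star_prod, ← prod_mul_distrib]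
  simp_rw [key]
  rw [sum_prod_blockCfg]

/-- **`⨂_b u_b` acts factorwise**: `(⨂_b u_b)(⨂_b χ_b) = ⨂_b (u_b χ_b)`. Tasaki (2020) §2.2. [folklore] -/
theorem blockProductOp_mulVec_blockProductStates (e : Λ ≃ B × F) (u : B → Op F q)
    (χ : B → TensorIndex F q → ℂ) :
    blockProductOp e u *ᵥ blockProductStates e χ = blockProductStates e (fun b => u b *ᵥ χ b) := by
  funext σ
  simp only [mulVec, dotProduct, blockProductOp_apply, blockProductStates_apply]
  set h : B → TensorIndex F q → ℂ := fun b ξ => u b (blockCfg e σ b) ξ * χ b ξ with hh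
  have key : ∀ τ : TensorIndex Λ q,
      (∏ b, u b (blockCfg e σ b) (blockCfg e τ b)) * ∏ b, χ b (blockCfg e τ b) =
        ∏ b, h b (blockCfg e τ b) := by
    intro τ
    rw [← prod_mul_distrib]
  simp_rw [key]
  rw [sum_prod_blockCfg]

/-- **A single-site operator acts on one factor**: `a_x (⨂_b χ_b) = ⨂_b χ'_b` with
`χ'_b = a_f χ_b` for the block `b` of `x` (`e x = (b, f)`) and `χ'_{b'} = χ_{b'}` otherwise.
Tasaki (2020) §2.2, eq. (2.2.5). [folklore] -/
theorem onSite_mulVec_blockProductStates (e : Λ ≃ B × F) {x : Λ} {b : B} {f : F}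
    (hx : e x = (b, f)) (a : Matrix (Fin q) (Fin q) ℂ) (χ : B → TensorIndex F q → ℂ) :
    onSite x a *ᵥ blockProductStates e χ =
      blockProductStates e (Function.update χ b (onSite f a *ᵥ χ b)) := by
  rw [onSite_eq_blockProductOp e hx, blockProductOp_mulVec_blockProductStates]
  congr 1
  funext b'
  by_cases hb' : b' = b
  · subst hb'
    simp
  · simp [Function.update_of_ne hb']

/-! ### Corners: an embedded operator meeting each block at most once -/

section Corners

variable [Fintype G] [DecidableEq G]

omit [Fintype Λ] [DecidableEq Λ] [Fintype B] [DecidableEq G] in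
/-- At the block of the site `g` the corner operator is `onSite (pos g) (m g)` (`blk` injective). [this file] -/
theorem cornerOp_apply_blk {blk : G → B} (hinj : Function.Injective blk) (pos : G → F)
    (m : G → Matrix (Fin q) (Fin q) ℂ) (g : G) :
    cornerOp blk pos m (blk g) = onSite (pos g) (m g) := by
  unfold cornerOp
  rw [sum_eq_single g]
  · simp
  · intro g' _ hg'
    rw [if_neg fun h => hg' (hinj h)]
  · exact fun h => absurd (mem_univ g) h

omit [Fintype Λ] [DecidableEq Λ] [Fintype B] [DecidableEq G] in
/-- Off the touched blocks the corner operator is the identity. [this file] -/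
theorem cornerOp_apply_of_ne (blk : G → B) (pos : G → F) (m : G → Matrix (Fin q) (Fin q) ℂ)
    {a : B} (ha : ∀ g, blk g ≠ a) : cornerOp blk pos m a = 1 := by
  unfold cornerOp
  rw [sum_eq_zero fun g _ => if_neg (ha g), add_zero]

omit [Fintype Λ] [DecidableEq Λ] [Fintype B] [DecidableEq B] [Fintype F] [DecidableEq F]
  [Fintype G] [DecidableEq G] in
/-- Which sites are corners: `e⁻¹(a, f)` is the site `emb g` iff `(a, f) = (blk g, pos g)`. [this file] -/
theorem symm_eq_emb_iff (e : Λ ≃ B × F) {emb : G ↪ Λ} {blk : G → B} {pos : G → F}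
    (h : ∀ g, e (emb g) = (blk g, pos g)) (a : B) (f : F) (g : G) :
    e.symm (a, f) = emb g ↔ blk g = a ∧ pos g = f := by
  rw [Equiv.symm_apply_eq, h, Prod.ext_iff]
  exact ⟨fun ⟨h1, h2⟩ => ⟨h1.symm, h2.symm⟩, fun ⟨h1, h2⟩ => ⟨h1.symm, h2.symm⟩⟩

/-- **An embedded matrix unit is a block product of corner units**: if the sites `emb g` lie in
pairwise different blocks (`e (emb g) = (blk g, pos g)`, `blk` injective), then
`spinEmbed emb |l⟩⟨l'| = ⨂_a C_a` with `C_{blk g} = onSite (pos g) |l g⟩⟨l' g|` and `C_a = 𝟙`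
otherwise. Bratteli–Robinson II §6.2.1. [this file] -/
theorem spinEmbed_single_eq_blockProductOp (e : Λ ≃ B × F) {emb : G ↪ Λ} {blk : G → B}
    {pos : G → F} (h : ∀ g, e (emb g) = (blk g, pos g)) (hinj : Function.Injective blk)
    (l l' : TensorIndex G q) :
    spinEmbed emb (single l l' (1 : ℂ)) =
      blockProductOp e (cornerOp blk pos fun g => single (l g) (l' g) (1 : ℂ)) := by
  ext σ τ
  rw [spinEmbed_apply, blockProductOp_apply, Matrix.single_apply]
  -- the value of `σ`/`τ` at a corner, read in block coordinates
  have hcorner : ∀ (ρ : TensorIndex Λ q) (g : G), blockCfg e ρ (blk g) (pos g) = ρ (emb g) := by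
    intro ρ g
    simp only [blockCfg]
    rw [(symm_eq_emb_iff e h (blk g) (pos g) g).2 ⟨rfl, rfl⟩]
  -- entries of the factors
  have hfac_blk : ∀ g, cornerOp blk pos (fun g => single (l g) (l' g) (1 : ℂ)) (blk g)
      (blockCfg e σ (blk g)) (blockCfg e τ (blk g)) =
      if (∀ f, f ≠ pos g → blockCfg e σ (blk g) f = blockCfg e τ (blk g) f) then
        (if l g = σ (emb g) ∧ l' g = τ (emb g) then 1 else 0) else 0 := by
    intro g
    rw [cornerOp_apply_blk hinj, onSite_apply, hcorner, hcorner, Matrix.single_apply]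
  have hfac_off : ∀ a, (∀ g, blk g ≠ a) → cornerOp blk pos (fun g => single (l g) (l' g) (1 : ℂ)) a
      (blockCfg e σ a) (blockCfg e τ a) = if blockCfg e σ a = blockCfg e τ a then 1 else 0 := by
    intro a ha
    rw [cornerOp_apply_of_ne blk pos _ ha, one_apply]
  by_cases hoff : ∀ y, y ∉ Set.range emb → σ y = τ y
  · rw [if_pos hoff]
    -- off the corners everything agrees, in block coordinates
    have hagree : ∀ (a : B) (f : F), (∀ g, blk g = a → pos g ≠ f) →
        blockCfg e σ a f = blockCfg e τ a f := by
      intro a f hne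
      simp only [blockCfg]
      refine hoff _ fun ⟨g, hg⟩ => ?_
      obtain ⟨h1, h2⟩ := (symm_eq_emb_iff e h a f g).1 hg.symm
      exact hne g h1 h2
    by_cases hl : l = (fun g => σ (emb g)) ∧ l' = fun g => τ (emb g)
    · rw [if_pos hl]
      refine (prod_eq_one fun a _ => ?_).symm
      by_cases ha : ∃ g, blk g = a
      · obtain ⟨g, rfl⟩ := ha
        rw [hfac_blk, if_pos, if_pos ⟨congrFun hl.1 g, congrFun hl.2 g⟩]
        intro f hf
        exact hagree _ f fun g' hg' => by rw [hinj hg']; exact fun hh => hf hh.symm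
      · push Not at ha
        rw [hfac_off a ha, if_pos (funext fun f => hagree a f fun g hg => absurd hg (ha g))]
    · rw [if_neg hl]
      have hg : ∃ g, ¬ (l g = σ (emb g) ∧ l' g = τ (emb g)) := by
        by_contra hall
        push Not at hall
        exact hl ⟨funext fun g => (hall g).1, funext fun g => (hall g).2⟩
      obtain ⟨g, hg⟩ := hg
      refine (prod_eq_zero (mem_univ (blk g)) ?_).symm
      rw [hfac_blk]
      split_ifs <;> rfl
  · rw [if_neg hoff]
    push Not at hoff
    obtain ⟨y, hy, hne⟩ := hoff
    refine (prod_eq_zero (mem_univ (e y).1) ?_).symm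
    have hval : blockCfg e σ (e y).1 (e y).2 ≠ blockCfg e τ (e y).1 (e y).2 := by
      rwa [blockCfg_apply_fst_snd, blockCfg_apply_fst_snd]
    by_cases ha : ∃ g, blk g = (e y).1
    · obtain ⟨g, hg⟩ := ha
      rw [← hg] at hval
      rw [← hg, hfac_blk, if_neg]
      intro hall
      refine hval (hall (e y).2 fun hp => hy ⟨g, ?_⟩)
      have h1 : e.symm ((e y).1, (e y).2) = emb g :=
        (symm_eq_emb_iff e h _ _ g).2 ⟨hg, hp.symm⟩
      rw [Prod.mk.eta, Equiv.symm_apply_apply] at h1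
      exact h1.symm
    · push Not at ha
      rw [hfac_off _ ha, if_neg]
      exact fun hh => hval (congrFun hh _)

/-- **An embedded operator acts on a block product state matrix unit by matrix unit**:
`(spinEmbed emb X)(⨂_a χ_a) = Σ_{l,l'} X l l' · ⨂_a (C^{l l'}_a χ_a)` with the corner operators
`C^{l l'}` of `spinEmbed_single_eq_blockProductOp`. [this file] -/
theorem spinEmbed_mulVec_blockProductStates (e : Λ ≃ B × F) {emb : G ↪ Λ} {blk : G → B}
    {pos : G → F} (h : ∀ g, e (emb g) = (blk g, pos g)) (hinj : Function.Injective blk)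
    (X : Op G q) (χ : B → TensorIndex F q → ℂ) :
    spinEmbed emb X *ᵥ blockProductStates e χ =
      ∑ l : TensorIndex G q, ∑ l' : TensorIndex G q, X l l' •
        blockProductStates e (fun a =>
          cornerOp blk pos (fun g => single (l g) (l' g) (1 : ℂ)) a *ᵥ χ a) := by
  conv_lhs => rw [matrix_eq_sum_single X]
  simp only [map_sum, Matrix.sum_mulVec]
  refine sum_congr rfl fun l _ => sum_congr rfl fun l' _ => ?_
  have hs : single l l' (X l l') = X l l' • single l l' (1 : ℂ) := by
    rw [smul_single, smul_eq_mul, mul_one]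
  rw [hs, map_smul, smul_mulVec, spinEmbed_single_eq_blockProductOp e h hinj,
    blockProductOp_mulVec_blockProductStates]

/-- **Expectation of an embedded operator between block product states**:
`⟨⨂_a χ⁰_a, (spinEmbed emb X) ⨂_a χ_a⟩ = Σ_{l,l'} X l l' ∏_a ⟨χ⁰_a, C^{l l'}_a χ_a⟩`. [this file] -/
theorem expect_spinEmbed_blockProductStates (e : Λ ≃ B × F) {emb : G ↪ Λ} {blk : G → B}
    {pos : G → F} (h : ∀ g, e (emb g) = (blk g, pos g)) (hinj : Function.Injective blk)
    (X : Op G q) (χ₀ χ : B → TensorIndex F q → ℂ) :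
    star (blockProductStates e χ₀) ⬝ᵥ (spinEmbed emb X *ᵥ blockProductStates e χ) =
      ∑ l : TensorIndex G q, ∑ l' : TensorIndex G q, X l l' *
        ∏ a, (star (χ₀ a) ⬝ᵥ
          (cornerOp blk pos (fun g => single (l g) (l' g) (1 : ℂ)) a *ᵥ χ a)) := by
  rw [spinEmbed_mulVec_blockProductStates e h hinj]
  simp only [dotProduct_sum, dotProduct_smul, smul_eq_mul, star_blockProductStates_dotProduct]

end Corners

end Algebra

end Summit.HubbardSuperconductivity.HubbardLadder.Bounds
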